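import Mathlib.Tactic.Ring
import Mathlib.Tactic.NormNum
import Mathlib.Tactic.Linarith
import Summits.CriticalPhenomena.PercolationContinuityZ3.Theorems.PercNearOneGluingNoHeavyLowerTailSahiCTCGroundBlocks
import HarnessLib

/-!
# `NoHeavyLowerTail` (crux stmt-CriticalPhenomena-4575), P3 lane: the COMPLEX-NEWTON blocks of g9 §7.3 — `|K₁|² − 2|K₂|` and
# `|K₁|·|K_{≥2}| − 3|K_{≥3}|` are coefficientwise nonnegative for a down-set `K` — and their status-rectangle forms

Support file (seat `prim-l12-p3`, gen 19; `--supports stmt-CriticalPhenomena-4575`).  Memo `run/shared/lean/prim/prim-l12/FROM-prim-l12-p3-g19-CERTIFICATE-ROAD-G011.md`.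
Nothing is asserted about the crux.

"Complex-Newton for a complex K: |K_1|² − 2|K_2|, |K_1|(|K_2|+|K_{≥3}|) − 3|K_{≥3}| (a j-face has j ≥ 3 splits vertex ⊔ (j−1)-face inside K)" (g9 §7.3).
Proved profile-wise: a 2-face `{i,j} ∈ K` has the two ordered splittings `{i} ⊔ {j}`, a face `T` with `#T ≥ 3` the `#T` splittings `{i} ⊔ (T ∖ i)`.
Also `cw_of_add_self` (halving, for certificates with multipliers `λ = 1/2`).
-/

namespace Summit.CriticalPhenomena.PercolationContinuityZ3.Theorems.SahiCTCForms

open Finset MvPolynomial SahiCTCGenFun SahiCTCWeightedLYM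

variable {α : Type*} [DecidableEq α]

/-! ### Complex-Newton blocks (g9 §7.3): `|K₁|² − 2|K₂|` and `|K₁|·|K_{≥2}| − 3|K_{≥3}|` for a down-set `K` -/

/-- `1_{{i}} + 1_{S ∖ i} = 1_S` for `i ∈ S`. [this work] -/
theorem ind_singleton_add_ind_erase {S : Finset α} {i : α} (hi : i ∈ S) : ind {i} + ind (S.erase i) = ind S := by
  have h : S = insert i (S.erase i) := (insert_erase hi).symm
  conv_rhs => rw [h]
  rw [ind_insert (notMem_erase i S)]
  unfold ind; rw [sum_singleton]

/-- At most one member of a family has a given exponent vector. [this work] -/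
theorem card_filter_ind_eq_le_one (F : Finset (Finset α)) (n : α →₀ ℕ) : #(F.filter fun S => ind S = n) ≤ 1 := by
  refine card_le_one.2 fun S hS T hT => ?_
  exact ind_injective ((mem_filter.1 hS).2.trans (mem_filter.1 hT).2.symm)

/-- **Complex-Newton block 1**: for a down-set `K`, every coefficient of `2·GF(K₂)` is at most that of `GF(K₁)²` (a pair `{i,j} ∈ K` gives the two ordered
splittings `{i} ⊔ {j}`); stated as `GF(K₁)·GF(K₁) − (GF(K₂) + GF(K₂)) ∈ ℕ[r]`. [this work] -/
theorem coeff_cn1_sub_nonneg {K : Finset (Finset α)} (hK : IsLowerSet (K : Set (Finset α))) (n : α →₀ ℕ) :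
    0 ≤ (gf (K.filter fun S => #S = 1) * gf (K.filter fun S => #S = 1) - (gf (K.filter fun S => #S = 2) + gf (K.filter fun S => #S = 2))).coeff n := by
  rw [coeff_sub, coeff_add, sub_nonneg, coeff_gf_mul_gf, coeff_gf]
  set K1 := K.filter fun S => #S = 1
  rcases (K.filter (fun S => #S = 2) |>.filter fun S => ind S = n).eq_empty_or_nonempty with h0 | ⟨T, hT⟩
  · rw [h0, card_empty]; push_cast; exact_mod_cast Nat.zero_le _
  · have hle := card_filter_ind_eq_le_one (K.filter fun S => #S = 2) n
    have hTmem := (mem_filter.1 (mem_filter.1 hT).1)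
    have hTK : T ∈ K := hTmem.1
    have hT2 : #T = 2 := hTmem.2
    have hTn : ind T = n := (mem_filter.1 hT).2
    obtain ⟨i, j, hij, rfl⟩ := card_eq_two.1 hT2
    have hiK : ({i} : Finset α) ∈ K1 := mem_filter.2 ⟨hK (show ({i} : Finset α) ⊆ {i, j} by simp) hTK, card_singleton i⟩
    have hjK : ({j} : Finset α) ∈ K1 := mem_filter.2 ⟨hK (show ({j} : Finset α) ⊆ {i, j} by simp) hTK, card_singleton j⟩
    have hsum : ind ({i} : Finset α) + ind ({j} : Finset α) = n := by
      rw [← hTn, ← ind_singleton_add_ind_erase (mem_insert_self i {j})]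
      congr 1; rw [erase_insert (by simpa using hij)]
    have hsum' : ind ({j} : Finset α) + ind ({i} : Finset α) = n := by rw [add_comm]; exact hsum
    have two : 2 ≤ #((K1 ×ˢ K1).filter fun PS => ind PS.1 + ind PS.2 = n) := by
      have hsub : ({(({i} : Finset α), ({j} : Finset α)), (({j} : Finset α), ({i} : Finset α))} : Finset (Finset α × Finset α)) ⊆
          (K1 ×ˢ K1).filter fun PS => ind PS.1 + ind PS.2 = n := by
        intro PS hPS
        rcases mem_insert.1 hPS with rfl | hPS
        · exact mem_filter.2 ⟨mem_product.2 ⟨hiK, hjK⟩, hsum⟩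
        · rw [mem_singleton] at hPS; subst hPS
          exact mem_filter.2 ⟨mem_product.2 ⟨hjK, hiK⟩, hsum'⟩
      have hne : ((({i} : Finset α), ({j} : Finset α)) : Finset α × Finset α) ≠ (({j} : Finset α), ({i} : Finset α)) := by
        intro h; exact hij (singleton_injective (Prod.ext_iff.1 h).1)
      calc 2 = #({(({i} : Finset α), ({j} : Finset α)), (({j} : Finset α), ({i} : Finset α))} : Finset (Finset α × Finset α)) := by
            rw [card_insert_of_notMem (by simpa using hne), card_singleton]
        _ ≤ _ := card_le_card hsub
    have : (#((K.filter fun S => #S = 2).filter fun S => ind S = n) : ℤ) ≤ 1 := by exact_mod_cast hle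
    have : (2 : ℤ) ≤ #((K1 ×ˢ K1).filter fun PS => ind PS.1 + ind PS.2 = n) := by exact_mod_cast two
    linarith

/-- **Complex-Newton block 2**: for a down-set `K`, every coefficient of `3·GF(K_{≥3})` is at most that of `GF(K₁)·GF(K_{≥2})` (a face `T ∈ K` with
`#T ≥ 3` has the `#T` splittings `{i} ⊔ (T ∖ i)` inside `K`); stated as `GF(K₁)·GF(K_{≥2}) − (GF(K_{≥3}) + GF(K_{≥3}) + GF(K_{≥3})) ∈ ℕ[r]`. [this work] -/
theorem coeff_cn2_sub_nonneg {K : Finset (Finset α)} (hK : IsLowerSet (K : Set (Finset α))) (n : α →₀ ℕ) :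
    0 ≤ (gf (K.filter fun S => #S = 1) * gf (K.filter fun S => 2 ≤ #S)
      - (gf (K.filter fun S => 3 ≤ #S) + gf (K.filter fun S => 3 ≤ #S) + gf (K.filter fun S => 3 ≤ #S))).coeff n := by
  rw [coeff_sub, coeff_add, coeff_add, sub_nonneg, coeff_gf_mul_gf, coeff_gf]
  set K1 := K.filter fun S => #S = 1
  set K2 := K.filter fun S => 2 ≤ #S
  rcases (K.filter (fun S => 3 ≤ #S) |>.filter fun S => ind S = n).eq_empty_or_nonempty with h0 | ⟨T, hT⟩
  · rw [h0, card_empty]; push_cast; exact_mod_cast Nat.zero_le _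
  · have hle := card_filter_ind_eq_le_one (K.filter fun S => 3 ≤ #S) n
    have hTmem := (mem_filter.1 (mem_filter.1 hT).1)
    have hTK : T ∈ K := hTmem.1
    have hT3 : 3 ≤ #T := hTmem.2
    have hTn : ind T = n := (mem_filter.1 hT).2
    -- the injection i ↦ ({i}, T.erase i)
    have three : #T ≤ #((K1 ×ˢ K2).filter fun PS => ind PS.1 + ind PS.2 = n) := by
      refine card_le_card_of_injOn (fun i => (({i} : Finset α), T.erase i)) (fun i hi => ?_) (fun i _ i' _ h => ?_)
      · rw [mem_coe, mem_filter, mem_product]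
        refine ⟨⟨mem_filter.2 ⟨hK ?_ hTK, card_singleton i⟩, mem_filter.2 ⟨hK (erase_subset i T) hTK, ?_⟩⟩, ?_⟩
        · intro x hx; rw [mem_singleton] at hx; subst hx; exact hi
        · rw [card_erase_of_mem hi]; omega
        · rw [← hTn]; exact ind_singleton_add_ind_erase hi
      · exact singleton_injective (Prod.ext_iff.1 h).1
    have : (#((K.filter fun S => 3 ≤ #S).filter fun S => ind S = n) : ℤ) ≤ 1 := by exact_mod_cast hle
    have : (3 : ℤ) ≤ #((K1 ×ˢ K2).filter fun PS => ind PS.1 + ind PS.2 = n) := by exact_mod_cast hT3.trans three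
    linarith

section rect
variable {V' : Finset α} {KX KZ : Finset (Finset α)} {v : α}

/-- Level slices of a status family. [this work] -/
theorem statFam_filter_eq (P : ℕ → ℕ → ℕ → Prop) [∀ a b L, Decidable (P a b L)] (k : ℕ) (hk : 1 ≤ k) (hk' : k ≤ 2) :
    (statFam V' KX KZ v P).filter (fun S => #S = k) = statFam V' KX KZ v (fun a b L => P a b L ∧ L = k) :=
  statFam_filter_card P (fun c => c = k) (fun L => L = k) fun S => by unfold lvl; omega
/-- Level slice `≥ 3` of a status family. [this work] -/
theorem statFam_filter_ge3 (P : ℕ → ℕ → ℕ → Prop) [∀ a b L, Decidable (P a b L)] :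
    (statFam V' KX KZ v P).filter (fun S => 3 ≤ #S) = statFam V' KX KZ v (fun a b L => P a b L ∧ L = 3) :=
  statFam_filter_card P (fun c => 3 ≤ c) (fun L => L = 3) fun S => by unfold lvl; omega

/-- **Complex-Newton block 1 on a status rectangle** (the shape used by the certificate files: `CN[K:B²−2C]`). [this work] -/
theorem coeff_cn1Rect_sub_nonneg (hKX : IsLowerSet (KX : Set (Finset α))) (hKZ : IsLowerSet (KZ : Set (Finset α))) (xa xb : ℕ) (n : α →₀ ℕ) :
    0 ≤ (gf (statFam V' KX KZ v (fun a b L => (a ≤ xa ∧ b ≤ xb ∧ L ≤ 3) ∧ L = 1)) * gf (statFam V' KX KZ v (fun a b L => (a ≤ xa ∧ b ≤ xb ∧ L ≤ 3) ∧ L = 1))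
      - (gf (statFam V' KX KZ v (fun a b L => (a ≤ xa ∧ b ≤ xb ∧ L ≤ 3) ∧ L = 2))
        + gf (statFam V' KX KZ v (fun a b L => (a ≤ xa ∧ b ≤ xb ∧ L ≤ 3) ∧ L = 2)))).coeff n := by
  have h := coeff_cn1_sub_nonneg (isLowerSet_statFam_rect (V' := V') (v := v) hKX hKZ xa xb 3) n
  rw [statFam_filter_eq _ 1 le_rfl (by norm_num), statFam_filter_eq _ 2 (by norm_num) le_rfl] at h
  exact h

/-- **Complex-Newton block 2 on a status rectangle** (`CN[K:B(C+D)−3D]`). [this work] -/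
theorem coeff_cn2Rect_sub_nonneg (hKX : IsLowerSet (KX : Set (Finset α))) (hKZ : IsLowerSet (KZ : Set (Finset α))) (xa xb : ℕ) (n : α →₀ ℕ) :
    0 ≤ (gf (statFam V' KX KZ v (fun a b L => (a ≤ xa ∧ b ≤ xb ∧ L ≤ 3) ∧ L = 1)) * gf (statFam V' KX KZ v (fun a b L => (a ≤ xa ∧ b ≤ xb ∧ L ≤ 3) ∧ 2 ≤ L))
      - (gf (statFam V' KX KZ v (fun a b L => (a ≤ xa ∧ b ≤ xb ∧ L ≤ 3) ∧ L = 3)) + gf (statFam V' KX KZ v (fun a b L => (a ≤ xa ∧ b ≤ xb ∧ L ≤ 3) ∧ L = 3))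
        + gf (statFam V' KX KZ v (fun a b L => (a ≤ xa ∧ b ≤ xb ∧ L ≤ 3) ∧ L = 3)))).coeff n := by
  have h := coeff_cn2_sub_nonneg (isLowerSet_statFam_rect (V' := V') (v := v) hKX hKZ xa xb 3) n
  rw [statFam_filter_eq _ 1 le_rfl (by norm_num), statFam_filter_ge2, statFam_filter_ge3] at h
  exact h

omit [DecidableEq α] in
/-- Halving: if `P + P` has nonnegative coefficients then so has `P` (for the certificates with multipliers `λ = 1/2`). [this work] -/
theorem cw_of_add_self {P : MvPolynomial α ℤ} (h : ∀ m, 0 ≤ (P + P).coeff m) : ∀ m, 0 ≤ P.coeff m := by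
  intro m; have := h m; rw [coeff_add] at this; linarith

end rect

end Summit.CriticalPhenomena.PercolationContinuityZ3.Theorems.SahiCTCForms
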